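import Mathlib
import Summits.HodgeConjecture.FermatCycles.HodgeFermatTheoremKRA

/-!
# THEOREM KR6 — part 2: `propL7cN` and the shared configuration (`HodgeFermat/TheoremKR.lean`; HF-G28)

Tree copy (part 2 of 3) of the module `HodgeFermat/TheoremKR.lean` of the sibling cell's standalone package
`run/shared/lean/pub/pub-hodgefermat/lean/HodgeFermat/` (793 lines, sha256 `b514baea4362d10e…`), source lines 295–531 (§§5–6: PROPOSITION L7(c) with a single non-congruence `propL7cN`, the eliminations, the shared configuration).
Filed by cell `pub-hfermat`, seat prover-1 gen-3, on the COORDINATOR KEEPER RULING of 2026-08-25 (gem sweep H1: take the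
off-gate kernel theorem `thmFstar` through the gate) — here THEOREM F* of `tables/DPRIME-THEOREM.md` §9 IN FULL, i.e.
PROPOSITION D′(3N) and the descent (`HodgeFermat/PropDPrimeNFinal.lean`, GATE HF-G34), the last off-gate form of THEOREM F*
(its first two forms, `DecodingFinal.thmFstar` = F* at the prime levels and `ThmFstarNFinal.thmFstar` = F*(3N), landed on
2026-08-25 as `HodgeFermatThmFstar.lean` / `HodgeFermatThmFstarN.lean`, seats prover-1 gen-0 / gen-2); this file is one link of
the import closure of `PropDPrimeNFinal.propDprime` (the sibling's KR-free chain: THEOREM L, COROLLARY M, THEOREM D6,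
THEOREM U⁺, THEOREM KR6, THEOREM Z3U) on top of those landed chains.  The source module is the sibling's hub-checked module of
record (pub-hodgefermat `CERT.md` l.927, GATE HF-G28); its declarations are copied VERBATIM.
Deviations from the source module, exhaustively: the `import` lines (tree modules `Summits.HodgeConjecture.FermatCycles.
HodgeFermat*` instead of `HodgeFermat.*`); this module docstring; the `set_option`/namespace/`open` preamble (source l.50–56) and part 1's four re-binding `open` lines are repeated at the top because the module is split; DEDUP (pre-empting the gate's `dedup.landed`): the source's `theorem propL7c_of_propL7cN : PropL7c` (l.405–408, a re-derivation used nowhere) has exactly the statement of `HodgeFermat.KRFree.PropL7c.propL7c` (`HodgeFermatPropL7cB.lean`) and is DELETED. The module docstring is quoted in full in part 1.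
Every other line — in particular every declaration's statement and proof — is byte-identical to the source.
HONEST FRAMING: explicit algebraic cycles for specific Hodge classes on Fermat/Delsarte varieties; residual open instances
listed; no claim on general Hodge.  (This file is arithmetic of CM types / finite combinatorics / analytic number theory
of the sibling's KR-free programme; it claims nothing about cycles.)
-/

set_option autoImplicit false

namespace HodgeFermat.KRFree.TheoremKR

open Finset HodgeFermat.KRFree HodgeFermat.KRFree.LemmaN HodgeFermat.KRFree.LemmaO HodgeFermat.KRFree.TheoremL
  HodgeFermat.KRFree.Bridge HodgeFermat.KRFree.TheoremD6 HodgeFermat.KRFree.PropL7c HodgeFermat.KRFree.TheoremU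
open HodgeFermat.KRFree.TheoremUEq (Perm3 zmod_multiset_eq)

open HodgeFermat.KRFree.Decoding renaming st_symm → sameType_symm, st_trans → sameType_trans, st_swap → sameType_swap, st_rot → sameType_rot, unit_mul_not_dvd → not_dvd_unit_mul
open HodgeFermat.KRFree.Decoding (rsum_swap rsum_rot)
open HodgeFermat.KRFree.TheoremZ3U renaming not_dvd_cofactor' → not_dvd_cofactor, rsum_const₃ → rsum_const_of_dvd
open HodgeFermat.KRFree.PropZ5 (mul_mod_mod)

/-! ## PROPOSITION L7(c) with the single non-congruence `7y ≢ 7y' (mod 7n)` in place of disjointness -/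

/-- **PROPOSITION L7(c), non-congruence form**: at a squarefree level `7n` prime to 6, a jointly primitive (Z1, Z1)
pair at 7, `T = (7y, x₂, x₃)`, `T' = (7y', x₂', x₃')` with `7y ≢ 7y' (mod 7n)`, does not have equal CM types.
(The proof of `PropL7c.propL7c`, generation 22, verbatim up to its three uses of disjointness, each of which was
`7y ≢ 7y'`.) -/
theorem propL7cN (n y x₂ x₃ y' x₂' x₃' : ℕ) (hsq : Squarefree n) (h7n : ¬ 7 ∣ n) (h3 : ¬ 3 ∣ n) (hodd : Odd n)
    (hs : 7 * n ∣ 7 * y + x₂ + x₃) (hx₂ : ¬ 7 ∣ x₂) (hx₃ : ¬ 7 ∣ x₃) (hy : ¬ n ∣ y)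
    (hs' : 7 * n ∣ 7 * y' + x₂' + x₃') (hx₂' : ¬ 7 ∣ x₂') (hx₃' : ¬ 7 ∣ x₃') (hy' : ¬ n ∣ y')
    (hjp : JP (7 * n) (7 * y, x₂, x₃) (7 * y', x₂', x₃'))
    (hne : ¬ 7 * y ≡ 7 * y' [MOD 7 * n])
    (hH : SameType (7 * n) (7 * y, x₂, x₃) (7 * y', x₂', x₃')) : False := by
  have hp : (7).Prime := by norm_num
  have hn : 0 < n := hodd.pos
  have h7cop : Nat.Coprime 7 n := (Nat.Prime.coprime_iff_not_dvd hp).mpr h7n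
  -- y ≢ y' (mod n)
  have hyy' : ¬ y ≡ y' [MOD n] := fun h => hne (h.mul_left' 7)
  -- the (Z1,Z1) row at 7 with 3 ∤ n: n = 5g, g = gcd(y − y', n), y − y' ≡ g v, 5 ∤ v
  have hrow := row_Z1Z1_seven_not3 n y x₂ x₃ y' x₂' x₃' h7n hn hodd h3 hs hx₂ hx₃ hs' hx₂' hx₃' hyy' hH
  obtain ⟨g, hg⟩ : ∃ g, Nat.gcd (y + (n - 1) * y') n = g := ⟨_, rfl⟩
  have hgpos : 0 < Nat.gcd (y + (n - 1) * y') n := Nat.gcd_pos_of_pos_right _ hn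
  have hcop := Nat.coprime_div_gcd_div_gcd hgpos
  rw [hg] at hrow hcop hgpos
  rw [hrow] at hcop
  have hgn : g ∣ n := hg ▸ Nat.gcd_dvd_right _ _
  have hgz : g ∣ y + (n - 1) * y' := hg ▸ Nat.gcd_dvd_left _ _
  have hn5 : n = 5 * g := by
    have h := Nat.div_mul_cancel hgn
    rw [hrow] at h
    omega
  obtain ⟨v, hzv⟩ := hgz
  rw [hzv, Nat.mul_div_cancel_left v hgpos] at hcop
  have h5g : ¬ 5 ∣ g := not_dvd_cofactor (by norm_num) (hn5 ▸ hsq)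
  have hsn : n ∣ 7 * y + x₂ + x₃ := dvd_of_level hs
  -- the CM type of T̄ at level n (PropL7c §2)
  obtain ⟨nz₂, nz₃, hT⟩ := Z1Z1_seven_type n g v y x₂ x₃ y' x₂' x₃' h7n hn hs hx₂ hx₃ hs' hx₂' hx₃' hy hy'
    hn5 hzv hcop hH
  have nz₁ : ¬ n ∣ 7 * y := not_dvd_unit_mul h7cop hy
  subst hn5
  by_cases hg1 : g = 1
  · -- N = 35: F35
    subst hg1
    have e35 : 7 * (5 * 1) = 35 := by norm_num
    rw [e35] at hs hs' hH hne
    have h₁ : ¬ 35 ∣ 7 * y := fun h => hy (Nat.dvd_of_mul_dvd_mul_left (by norm_num : 0 < 7)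
      (by simpa using h))
    have h₁' : ¬ 35 ∣ 7 * y' := fun h => hy' (Nat.dvd_of_mul_dvd_mul_left (by norm_num : 0 < 7)
      (by simpa using h))
    have h₂ : ¬ 35 ∣ x₂ := fun h => hx₂ (Nat.dvd_trans ⟨5, by norm_num⟩ h)
    have h₃ : ¬ 35 ∣ x₃ := fun h => hx₃ (Nat.dvd_trans ⟨5, by norm_num⟩ h)
    have h₂' : ¬ 35 ∣ x₂' := fun h => hx₂' (Nat.dvd_trans ⟨5, by norm_num⟩ h)
    have h₃' : ¬ 35 ∣ x₃' := fun h => hx₃' (Nat.dvd_trans ⟨5, by norm_num⟩ h)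
    rcases coincidenceFree_first F35 (by norm_num) (7 * y) x₂ x₃ (7 * y') x₂' x₃' hs hs' h₁ h₂ h₃ h₁' h₂'
      h₃' hH with h | h | h
    · exact hne h
    · exact hx₂' (by omega)
    · exact hx₃' (by omega)
  · -- g > 1: a prime q of g, q ≥ 11
    obtain ⟨q, hq, hqg⟩ := Nat.exists_prime_and_dvd hg1
    have hqn : q ∣ 5 * g := Nat.dvd_trans hqg (dvd_mul_left g 5)
    have hq5 : q ≠ 5 := fun h => h5g (h ▸ hqg)
    have h7q : 7 ≤ q := seven_le_prime hq hqn hodd h3 hq5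
    have hq7 : ¬ q ∣ 7 := by
      intro h
      have := (Nat.prime_dvd_prime_iff_eq hq (by norm_num)).mp h
      subst this
      exact h7n hqn
    obtain ⟨g', rfl⟩ := hqg
    have hsq' : Squarefree (q * (5 * g')) := by rwa [show q * (5 * g') = 5 * (q * g') by ring]
    have hq5g' : ¬ q ∣ 5 * g' := not_dvd_cofactor hq hsq'
    have hg'0 : 0 < 5 * g' := by have := pos_right hgpos; omega
    have hodd5 : Odd (5 * g') := by
      rw [show 5 * (q * g') = q * (5 * g') by ring] at hodd
      exact (Nat.odd_mul.mp hodd).2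
    by_cases hZ3 : q ∣ 7 * y ∧ q ∣ x₂ ∧ q ∣ x₃
    · -- T is a Z3 triple at q at level 7n, T' is not (joint primitivity)
      obtain ⟨hd₁, hd₂, hd₃⟩ := hZ3
      have hqy : q ∣ y := ((Nat.Prime.dvd_mul hq).mp hd₁).resolve_left hq7
      obtain ⟨a, rfl⟩ := hqy
      obtain ⟨b, rfl⟩ := hd₂
      obtain ⟨c, rfl⟩ := hd₃
      have hqN' : ¬ q ∣ 7 * (5 * g') := fun h => ((Nat.Prime.dvd_mul hq).mp h).elim hq7 hq5g'
      have hN' : 0 < 7 * (5 * g') := by omega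
      have hodd' : Odd (7 * (5 * g')) := Nat.odd_mul.mpr ⟨⟨3, rfl⟩, hodd5⟩
      have elevel : q * (7 * (5 * g')) = 7 * (5 * (q * g')) := by ring
      have hs'' : q * (7 * (5 * g')) ∣ 7 * y' + x₂' + x₃' := by rw [elevel]; exact hs'
      have hq7n : q ∣ 7 * (5 * (q * g')) := ⟨7 * (5 * g'), by ring⟩
      have hne3 : ¬ (q ∣ 7 * y' ∧ q ∣ x₂' ∧ q ∣ x₃') := fun ⟨d1, d2, d3⟩ =>
        hjp q hq hq7n ⟨7 * a, by ring⟩ (dvd_mul_right q b) (dvd_mul_right q c) d1 d2 d3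
      have hu : ¬ q * (7 * (5 * g')) ∣ 7 * y' := fun h =>
        hy' (Nat.dvd_of_mul_dvd_mul_left (by norm_num : 0 < 7) (by rw [elevel] at h; exact h))
      have hv : ¬ q * (7 * (5 * g')) ∣ x₂' := fun h => hx₂' (Nat.dvd_trans ⟨q * (5 * g'), by ring⟩ h)
      have hw : ¬ q * (7 * (5 * g')) ∣ x₃' := fun h => hx₃' (Nat.dvd_trans ⟨q * (5 * g'), by ring⟩ h)
      have hH' : SameType (q * (7 * (5 * g'))) (q * (7 * a), q * b, q * c) (7 * y', x₂', x₃') := by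
        rw [elevel, show q * (7 * a) = 7 * (q * a) by ring]; exact hH
      exact z3_vs_any q (7 * (5 * g')) (7 * a) b c (7 * y') x₂' x₃' hq h7q hqN' hN' hodd' hs'' hne3 hu hv hw hH'
    · -- V = g·(3v, 3v, 9v) is a Z3 triple at q at level n, T̄ ∼ V is not
      have elevel : q * (5 * g') = 5 * (q * g') := by ring
      have hsum : q * (5 * g') ∣ 7 * y + x₂ + x₃ := by rw [elevel]; exact hsn
      have hu : ¬ q * (5 * g') ∣ 7 * y := by rw [elevel]; exact nz₁
      have hv : ¬ q * (5 * g') ∣ x₂ := by rw [elevel]; exact nz₂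
      have hw : ¬ q * (5 * g') ∣ x₃ := by rw [elevel]; exact nz₃
      have hH' : SameType (q * (5 * g')) (q * (g' * (3 * v)), q * (g' * (3 * v)), q * (g' * (9 * v)))
          (7 * y, x₂, x₃) := by
        rw [elevel, show q * (g' * (3 * v)) = q * g' * (3 * v) by ring,
          show q * (g' * (9 * v)) = q * g' * (9 * v) by ring]
        exact sameType_symm hT
      exact z3_vs_any q (5 * g') (g' * (3 * v)) (g' * (3 * v)) (g' * (9 * v)) (7 * y) x₂ x₃ hq h7q hq5g'
        hg'0 hodd5 hsum hZ3 hu hv hw hH'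

-- `propL7c_of_propL7cN : PropL7c` (source l.405–408): DELETED — same statement as the landed `PropL7c.propL7c` (gate dedup); unused.

/-- (Z1, Z1) at a prime `q ≥ 7` with the two `q`-multiples (the first entries) NOT congruent mod `N`:
`row_Z1Z1_eleven` (`q ≥ 11`), `propL7cN` (`q = 7`) -/
lemma no_Z1Z1_ge7P {N a b c a' b' c' : ℕ} (S : PSetting N (a, b, c) (a', b', c')) {q : ℕ}
    (hq : q.Prime) (h7 : 7 ≤ q) (hqN : q ∣ N) (ha : q ∣ a) (hb : ¬ q ∣ b) (hc : ¬ q ∣ c)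
    (ha' : q ∣ a') (hb' : ¬ q ∣ b') (hc' : ¬ q ∣ c') (hne : ¬ a ≡ a' [MOD N]) : False := by
  have hodd := S.odd
  have h3N := S.three
  obtain ⟨n, rfl⟩ := hqN
  have hn0 : 0 < n := pos_right S.pos
  have hqn : ¬ q ∣ n := not_dvd_cofactor hq S.sq
  have hoddn : Odd n := (Nat.odd_mul.mp hodd).2
  have h3n : ¬ 3 ∣ n := fun h => h3N (Dvd.dvd.mul_left h q)
  have hsqn : Squarefree n := Squarefree.squarefree_of_dvd (dvd_mul_left n q) S.sq
  obtain ⟨y, rfl⟩ := ha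
  obtain ⟨y', rfl⟩ := ha'
  have hy : ¬ n ∣ y := fun h => S.nz₁ (Nat.mul_dvd_mul_left q h)
  have hy' : ¬ n ∣ y' := fun h => S.nz₁' (Nat.mul_dvd_mul_left q h)
  by_cases h11 : 11 ≤ q
  · have hyy' : ¬ y ≡ y' [MOD n] := fun e => hne (Nat.ModEq.mul_left' q e)
    exact row_Z1Z1_eleven q n y b c y' b' c' hq h11 hqn hn0 hoddn S.hsum hb hc S.hsum' hb' hc' hyy' S.same
  · have hq7 : q = 7 := by
      have hlt : q < 11 := by omega
      interval_cases q
      · rfl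
      · exact absurd hq (by norm_num)
      · exact absurd hq (by norm_num)
      · exact absurd hq (by norm_num)
    subst hq7
    exact propL7cN n y b c y' b' c' hsqn hqn h3n hoddn S.hsum hb hc hy S.hsum' hb' hc' hy' S.jp hne S.same

/-- no prime `q ≥ 7` of the level divides the first entry of the first triple, provided that entry is congruent to
no entry of the second triple -/
lemma elim_ge7P {N a b c a' b' c' : ℕ} (S : PSetting N (a, b, c) (a', b', c')) {q : ℕ}
    (hq : q.Prime) (h7 : 7 ≤ q) (hqN : q ∣ N) (ha : q ∣ a) (hno : NotIn N a (a', b', c')) : False := by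
  have hb : ¬ q ∣ b := fun hb => noZ3P S hq hqN ha hb (dvd_third hqN S.hsum ha hb)
  have hc : ¬ q ∣ c := fun hc => noZ3P S hq hqN ha (dvd_second hqN S.hsum ha hc) hc
  by_cases ha' : q ∣ a'
  · have hb' : ¬ q ∣ b' := fun h => noZ3P S.symm hq hqN ha' h (dvd_third hqN S.hsum' ha' h)
    have hc' : ¬ q ∣ c' := fun h => noZ3P S.symm hq hqN ha' (dvd_second hqN S.hsum' ha' h) h
    exact no_Z1Z1_ge7P S hq h7 hqN ha hb hc ha' hb' hc' hno.1
  · by_cases hb' : q ∣ b'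
    · have hc' : ¬ q ∣ c' := fun h => ha' (dvd_first hqN S.hsum' hb' h)
      exact no_Z1Z1_ge7P S.swap12' hq h7 hqN ha hb hc hb' ha' hc' hno.2.1
    · by_cases hc' : q ∣ c'
      · exact no_Z1Z1_ge7P S.rot' hq h7 hqN ha hb hc hc' ha' hb' hno.2.2
      · exact no_UZ1_ge7P S hq h7 hqN ha hb hc ha' hb' hc'

/-! ## The shared configuration: the wings are units -/

/-- a `q`-multiple wing `b` of a triple whose shared entry `a ≡ a'` is prime to `q` is congruent to no entry of the
other triple -/
lemma notIn_wing {N a b a' b' c' q : ℕ} (hqN : q ∣ N) (hsh : a ≡ a' [MOD N]) (hqa : ¬ q ∣ a) (hqb : q ∣ b)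
    (hw₁ : ¬ b ≡ b' [MOD N]) (hw₂ : ¬ b ≡ c' [MOD N]) : NotIn N b (a', b', c') := by
  refine ⟨fun e => hqa ?_, hw₁, hw₂⟩
  have e2 : b ≡ a [MOD q] := Nat.ModEq.of_dvd hqN (e.trans hsh.symm)
  exact (Nat.modEq_zero_iff_dvd).mp (e2.symm.trans ((Nat.modEq_zero_iff_dvd).mpr hqb))

/-- in the shared configuration (`a ≡ a'`, the wing `b` congruent to neither `b'` nor `c'`) the wing `b` is prime
to the part of the level prime to `5` -/
lemma wing_coprime7 {N a b c a' b' c' : ℕ} (S : PSetting N (a, b, c) (a', b', c')) (hsh : a ≡ a' [MOD N])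
    (hw₁ : ¬ b ≡ b' [MOD N]) (hw₂ : ¬ b ≡ c' [MOD N]) {n : ℕ} (hn : n ∣ N) (h5 : ¬ 5 ∣ n) :
    Nat.Coprime b n := by
  by_contra hco
  obtain ⟨r, hr, hrb, hrn⟩ := Nat.Prime.not_coprime_iff_dvd.mp hco
  have hrN : r ∣ N := dvd_trans hrn hn
  have hr5 : r ≠ 5 := fun h => h5 (h ▸ hrn)
  have h7 : 7 ≤ r := seven_le_prime hr hrN S.odd S.three hr5
  by_cases hra : r ∣ a
  · exact noZ3P S hr hrN hra hrb (dvd_third hrN S.hsum hra hrb)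
  · exact elim_ge7P S.swap12 hr h7 hrN hrb (notIn_wing hrN hsh hra hrb hw₁ hw₂)

/-- … and `5` does not divide the wing `b` either: PROPOSITIONS Z5 / L5 at levels `5n > 100`, the facts F5 … F95
below (here all four wing non-congruences are used: the `5`-multiple of `T'` is a wing too) -/
lemma elim5_wing {N a b c a' b' c' : ℕ} (S : PSetting N (a, b, c) (a', b', c')) (hsh : a ≡ a' [MOD N])
    (hw₁ : ¬ b ≡ b' [MOD N]) (hw₂ : ¬ b ≡ c' [MOD N]) (hw₃ : ¬ c ≡ b' [MOD N]) (hw₄ : ¬ c ≡ c' [MOD N])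
    (h5N : 5 ∣ N) (h5b : 5 ∣ b) : False := by
  by_cases h5a : 5 ∣ a
  · exact noZ3P S Nat.prime_five h5N h5a h5b (dvd_third h5N S.hsum h5a h5b)
  have h5c : ¬ 5 ∣ c := fun h => h5a (dvd_first h5N S.hsum h5b h)
  have h5a' : ¬ 5 ∣ a' := fun h => h5a ((Nat.modEq_zero_iff_dvd).mp
    ((Nat.ModEq.of_dvd h5N hsh).trans ((Nat.modEq_zero_iff_dvd).mpr h)))
  have hno : NotIn N b (a', b', c') := notIn_wing h5N hsh h5a h5b hw₁ hw₂
  have hodd := S.odd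
  have h3N := S.three
  obtain ⟨n, rfl⟩ := h5N
  by_cases hn20 : n ≤ 20
  · exact small5P S.swap12 hno hn20
  have hn : 20 < n := by omega
  have hnN : n ∣ 5 * n := dvd_mul_left n 5
  have h5n : ¬ 5 ∣ n := not_dvd_cofactor Nat.prime_five S.sq
  have h2n : ¬ 2 ∣ n := fun h => S.two (Dvd.dvd.mul_left h 5)
  have h3n : ¬ 3 ∣ n := fun h => h3N (Dvd.dvd.mul_left h 5)
  have hn30 : Nat.Coprime n 30 := coprime30 h2n h3n h5n
  have hco : Nat.Coprime b n := wing_coprime7 S hsh hw₁ hw₂ hnN h5n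
  have Sb := S.swap12
  by_cases h5b' : 5 ∣ b'
  · have h5c' : ¬ 5 ∣ c' := fun h => h5a' (dvd_first (dvd_mul_right 5 n) S.hsum' h5b' h)
    have hco' : Nat.Coprime b' n :=
      wing_coprime7 S.symm hsh.symm (fun e => hw₁ e.symm) (fun e => hw₃ e.symm) hnN h5n
    exact PropZ5.propZ5 n b a c b' a' c' hn hn30 Sb.hsum h5b hco h5a h5c Sb.swap12'.hsum' h5b' hco' h5a'
      h5c' hw₁ Sb.swap12'.same
  · by_cases h5c' : 5 ∣ c'
    · have hco' : Nat.Coprime c' n :=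
        wing_coprime7 S.symm.rot.swap12 hsh.symm (fun e => hw₂ e.symm) (fun e => hw₄ e.symm) hnN h5n
      exact PropZ5.propZ5 n b a c c' a' b' hn hn30 Sb.hsum h5b hco h5a h5c Sb.rot'.hsum' h5c' hco' h5a'
        h5b' hw₂ Sb.rot'.same
    · exact PropL5.propL5 n b a c a' b' c' hn h5n Sb.hsum h5b hco h5a h5c Sb.hsum' h5a' h5b' h5c' Sb.same

/-- in the shared configuration every wing is a unit mod `N` (here: the wing `b`) -/
lemma wing_coprime {N a b c a' b' c' : ℕ} (S : PSetting N (a, b, c) (a', b', c')) (hsh : a ≡ a' [MOD N])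
    (hw₁ : ¬ b ≡ b' [MOD N]) (hw₂ : ¬ b ≡ c' [MOD N]) (hw₃ : ¬ c ≡ b' [MOD N]) (hw₄ : ¬ c ≡ c' [MOD N]) :
    Nat.Coprime b N := by
  by_contra hco
  obtain ⟨q, hq, hqb, hqN⟩ := Nat.Prime.not_coprime_iff_dvd.mp hco
  by_cases hq5 : q = 5
  · subst hq5
    exact elim5_wing S hsh hw₁ hw₂ hw₃ hw₄ hqN hqb
  · have h7 : 7 ≤ q := seven_le_prime hq hqN S.odd S.three hq5
    by_cases hqa : q ∣ a
    · exact noZ3P S hq hqN hqa hqb (dvd_third hqN S.hsum hqa hqb)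
    · exact elim_ge7P S.swap12 hq h7 hqN hqb (notIn_wing hqN hsh hqa hqb hw₁ hw₂)


end HodgeFermat.KRFree.TheoremKR
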